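import Summits.BirchSwinnertonDyer.BirchSwinnertonDyer.Theorems.ErratumRoadFiveEulerHalfNotRamNoInertSetAtFiveOfFiveItemsFrobeniusLowerX11aFive
import Summits.BirchSwinnertonDyer.BirchSwinnertonDyer.Theorems.PrintX11aLowerHalfFiveOfChildren
import HarnessLib

/-!
# Route `ErratumRoadFive` (K2, `p ≥ 5`), crux `EulerHalfNotRamNoInertSetAtFive` (item stmt-BirchSwinnertonDyer-19715), line `birth` v17:
# THE BOTTOM LINE ACROSS THE K2 ∕ L BOUNDARY — crux 19715 BY NAME ⟸ FIVE ER5 published-input items + item 23091 + THREE of crux 19064's five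
# REGISTERED r16 children (print ×2 + ONE `∀`-certificate statement)
# (cell `bsd-stepL`, LEAD `bsd-line-er5-p1` g4 with the 19064 line's width seat bsd-line-er5-p2 g11; `--supports stmt-BirchSwinnertonDyer-19715 --as helper`)

WHAT. One composition, no new mathematics: the LEAD's five-item ∕ 23091 ∕ `p ≥ 5`-restriction closer
`EulerHalfLowerX11aFive.eulerHalfNotRamNoInertSetAtFive_of_fiveItems_of_frobeniusCongruence_of_lowerX11aFive` (p658518; over -w2 g6's
[GZ86 III (3.1)]-free chain p657893 and the re-key p655937) fed with the 19064 line's `Birth.lowerX11aFive_of_children_r16_three` (p657610: the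
`p ≥ 5` restriction of `X11aLowerHalf` from THREE of the five registered children of `Cruxes/X11aLowerHalf/Lines/birth.lean` r16 — the shared nine
`stub_nineFactsOddGS`, the eight chain facts `stub_chainFactsLower`, the both-images certificate `stub_muAnDeepFive`; binder texts byte-equal).
* `eulerHalfNotRamNoInertSetAtFive_of_fiveItems_of_frobeniusCongruence_of_x11aChildrenFive` (ROAD A) and `…_roadB`:
  **`Theses.ErratumRoadFive.EulerHalfNotRamNoInertSetAtFive` ⟸ `PublishedInputsFive` (19066), `ShimuraParametrizationDataNonempty` (19524),
  `PastenComponentOrdersInput` (19716), `ShimuraCasselsTateLevelInputs` (20191, closed), `ShimuraHeegnerEulerSystemInertPrintedR` (20442),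
  `GrossFrobeniusCongruenceImageFreeFact` (23091) — all PRINT, typed as named facts — + seventeen PRINTED facts of the 19064 line (h9, h8L) + ONE
  statement `hμ5`: Greenberg's analytic `μ = 0` (`X11a.MuAnZeroAt`) at every X11a pair with `p ≥ 5` whose `#Ш_an` is not a `p`-adic unit.**
So, read through the kernel, the Euler-system half of K2 at `p ≥ 5` on the ¬(ram) ∕ surj ∕ `p ∣ ∏c` residual is PRINT + that one certificate
statement (OPEN class-wide = Greenberg's `μ`-conjecture on the deep X11a locus at `p ≥ 5`, barrier B3; per pair a finite modular-symbol
computation — 158 ∕ 158 deep surjective pairs with `N < 5·10⁵` certified by the x11a cell, no deep non-surjective pair known in that range).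
Neither [GZ86 III (3.1)], nor 27982 ((B6)@carriers), nor the `p = 3` part of 19064 is an input.

HONEST FRAMING: THEOREMS ONLY — no definition, no named fact, no `sorry`; CONDITIONAL on every displayed binder; nothing is booked; item 19715 is NOT
closed (exact-match close only; its `_of` binds route ITEMS by name, RULING 67); no census number moves (404 = 69 + 334 + 1 + 0); BSD is proved for no
curve; no summit statement is touched.
[cite: GreenbergLNM1716, §1 Conj. 1.11 (p. 61)] [cite: Wan2015, Thm. 4 (pp. 4–5)] [cite: EmertonPollackWeston2006, Thm. 3.1.1, Thm. 1, Thm. 5.1.3]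
[cite: Kato2004Asterisque, Thm. 12.4 (p. 221), §17.13 (pp. 279–280)] [cite: Wuthrich2014, Thm. 3 (p. 382), Lemma 20] [cite: GrossLMS1991, Prop. 3.7 (2) (p. 240)]
[cite: Jetchev2008, Thm. 1.4, Cor. 1.5] [cite: PastenShimura2024, Lemma 6.18, Prop. 6.13] [cite: Miller2011LMS, §1, Def. 1.1]
-/

set_option autoImplicit false
set_option linter.dupNamespace false -- `Summit.BirchSwinnertonDyer.BirchSwinnertonDyer` (summit = problem), tree-wide

noncomputable section

open scoped Classical MatrixGroups ModularForm

open CongruenceSubgroup UpperHalfPlane WeierstrassCurve IsDedekindDomain Rat.HeightOneSpectrum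
  Literature.NumberTheory.EllipticCurves
  Literature.NumberTheory.EllipticCurves.ModularForms
  Literature.NumberTheory.EllipticCurves.Rank1Residual
  Literature.NumberTheory.EllipticCurves.Rank1Residual.Typed
  Literature.NumberTheory.EllipticCurves.Wuthrich2014
  Literature.NumberTheory.EllipticCurves.SteinWuthrich2013
  Literature.NumberTheory.EllipticCurves.Greenberg1999
  Literature.NumberTheory.EllipticCurves.Kato2004
  Literature.NumberTheory.EllipticCurves.GreenbergVatsal2000
  Literature.NumberTheory.EllipticCurves.EmertonPollackWeston2006
  Literature.NumberTheory.EllipticCurves.SkinnerUrban2014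
  Literature.NumberTheory.EllipticCurves.BalakrishnanEtAl2019
  Literature.NumberTheory.GaloisRepresentations
  Literature.NumberTheory.Automorphic
  Summit.BirchSwinnertonDyer.Rank1Residual
  Summit.BirchSwinnertonDyer.Rank1Residual.X11a
  Summit.BirchSwinnertonDyer.BirchSwinnertonDyer.Theorems.OddChain

namespace Summit.BirchSwinnertonDyer.BirchSwinnertonDyer.Theorems.EulerHalfLowerX11aFive

open Summit.BirchSwinnertonDyer.BirchSwinnertonDyer.Theses.ErratumRoadFive
  Summit.BirchSwinnertonDyer.BirchSwinnertonDyer.Theorems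

/-- **CRUX 19715 `EulerHalfNotRamNoInertSetAtFive` BY NAME ⟸ FIVE ER5 published-input items + item 23091 + THREE of crux 19064's five registered r16
children — ROAD A.** Binders: the ER5 items `PublishedInputsFive`, `ShimuraParametrizationDataNonempty`, `PastenComponentOrdersInput`,
`ShimuraCasselsTateLevelInputs`, `ShimuraHeegnerEulerSystemInertPrintedR`, `GrossFrobeniusCongruenceImageFreeFact`; the 19064 line's `stub_nineFactsOddGS`
text `h9` (Stein–Wuthrich 6.1 ×2, Greenberg–Stevens (odd), Kato 12.4, modularity, Kato §17.13 contra ×3, Mazur 4.1), `stub_chainFactsLower` text `h8L`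
(EPW 3.1.1 ∕ Thm. 1 ∕ 5.1.3 (odd), Wan Thm. 4 (irred), Deligne–Serre 6.1, Hida 3.26, Kato–Wuthrich A32, GZK) and `stub_muAnDeepFive` text `hμ5`
(Greenberg's analytic `μ = 0` on the deep X11a pairs at `p ≥ 5` — the ONE non-print statement). := p658518 ∘ p657610. CONDITIONAL; closes nothing;
BSD is proved for no curve. [cite: GreenbergLNM1716, §1 Conj. 1.11 (p. 61)] [cite: Wan2015, Thm. 4] [cite: GrossLMS1991, Prop. 3.7 (2)] [cite: Jetchev2008, Thm. 1.4] -/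
theorem eulerHalfNotRamNoInertSetAtFive_of_fiveItems_of_frobeniusCongruence_of_x11aChildrenFive
    (h₅ : PublishedInputsFive) (hJL : ShimuraParametrizationDataNonempty)
    (hCO : PastenComponentOrdersInput) (hCTi : ShimuraCasselsTateLevelInputs)
    (hESi : ShimuraHeegnerEulerSystemInertPrintedR) (hF₁ : GrossFrobeniusCongruenceImageFreeFact)
    -- the 19064 line's r16 children texts (VERBATIM from `PrintX11aLowerHalfFiveOfChildren` §1)
    (h9 : thm61_splitMultiplicative ∧ thm61_nonsplitMultiplicative ∧
      (∀ (W : WeierstrassCurve ℚ) [W.IsElliptic] [W.IsGloballyMinimal] (p : ℕ) [Fact p.Prime],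
        p ≠ 2 → greenberg_stevens (W := W) (p := p)) ∧
      Kato2004.thm12_4 ∧ exists_isNewformOf ∧
      Kato2004.exists_multDivisibilityInputs_nonsplit_contra ∧
      Kato2004.exists_multDivisibilityInputs_split_contra ∧
      Kato2004.exists_multDivisibilityInputs_fine_contra ∧ mazur_not_dvd_maninConstant_of_odd)
    (h8L : thm311_cotorsion_weightK_member_ofLevel_odd ∧ thm1_muAlg_of_weightK_member_ofLevel_odd ∧
      Wan2015.thm4_rational_weightK_member_of_bdd_ofLevel_irred ∧
      thm513_transfer_from_weightK_member_of_bdd_ofLevel_odd ∧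
      DeligneSerre1974.thm61_exists_adicGaloisRep ∧ Hida2000_thm326_ordinary ∧
      kato_charIdeal_dvd_multiplicative_of_surjective ∧
      rank_eq_analyticRank_of_analyticRank_le_one)
    (hμ5 : ∀ (W : WeierstrassCurve ℚ) [W.IsElliptic] [W.IsGloballyMinimal] (p : ℕ) [Fact p.Prime],
      ClassX11a W p → 5 ≤ p → ¬ X11a.ShaAnUnit W p → X11a.MuAnZeroAt W p) :
    EulerHalfNotRamNoInertSetAtFive :=
  eulerHalfNotRamNoInertSetAtFive_of_fiveItems_of_frobeniusCongruence_of_lowerX11aFive h₅ hJL hCO hCTi hESi hF₁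
    (Birth.lowerX11aFive_of_children_r16_three h9 h8L hμ5)

/-- **The same, ROAD B** (SAV from -w6 g0's `EulerHalfGalTrivialRoad.shimuraInertSavedDisplayAtFive_of_items`). CONDITIONAL; closes nothing; BSD is proved
for no curve. [cite: GreenbergLNM1716, §1 Conj. 1.11 (p. 61)] [cite: GrossLMS1991, Prop. 3.7 (2), §6] [cite: PastenShimura2024, Lemma 6.18] -/
theorem eulerHalfNotRamNoInertSetAtFive_of_fiveItems_of_frobeniusCongruence_of_x11aChildrenFive_roadB
    (h₅ : PublishedInputsFive) (hJL : ShimuraParametrizationDataNonempty)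
    (hCO : PastenComponentOrdersInput) (hCTi : ShimuraCasselsTateLevelInputs)
    (hESi : ShimuraHeegnerEulerSystemInertPrintedR) (hF₁ : GrossFrobeniusCongruenceImageFreeFact)
    (h9 : thm61_splitMultiplicative ∧ thm61_nonsplitMultiplicative ∧
      (∀ (W : WeierstrassCurve ℚ) [W.IsElliptic] [W.IsGloballyMinimal] (p : ℕ) [Fact p.Prime],
        p ≠ 2 → greenberg_stevens (W := W) (p := p)) ∧
      Kato2004.thm12_4 ∧ exists_isNewformOf ∧
      Kato2004.exists_multDivisibilityInputs_nonsplit_contra ∧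
      Kato2004.exists_multDivisibilityInputs_split_contra ∧
      Kato2004.exists_multDivisibilityInputs_fine_contra ∧ mazur_not_dvd_maninConstant_of_odd)
    (h8L : thm311_cotorsion_weightK_member_ofLevel_odd ∧ thm1_muAlg_of_weightK_member_ofLevel_odd ∧
      Wan2015.thm4_rational_weightK_member_of_bdd_ofLevel_irred ∧
      thm513_transfer_from_weightK_member_of_bdd_ofLevel_odd ∧
      DeligneSerre1974.thm61_exists_adicGaloisRep ∧ Hida2000_thm326_ordinary ∧
      kato_charIdeal_dvd_multiplicative_of_surjective ∧
      rank_eq_analyticRank_of_analyticRank_le_one)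
    (hμ5 : ∀ (W : WeierstrassCurve ℚ) [W.IsElliptic] [W.IsGloballyMinimal] (p : ℕ) [Fact p.Prime],
      ClassX11a W p → 5 ≤ p → ¬ X11a.ShaAnUnit W p → X11a.MuAnZeroAt W p) :
    EulerHalfNotRamNoInertSetAtFive :=
  eulerHalfNotRamNoInertSetAtFive_of_fiveItems_of_frobeniusCongruence_of_lowerX11aFive_roadB h₅ hJL hCO hCTi hESi hF₁
    (Birth.lowerX11aFive_of_children_r16_three h9 h8L hμ5)

/-! ### §2 The same across the 19064 line's r17 (of record since 18:49:45Z): FIVE printed x11a facts consumed + ONE statement — Mazur's cyclotomic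
main conjecture at the deep X11a pairs, `p ≥ 5` -/

/-- **CRUX 19715 BY NAME ⟸ FIVE ER5 published-input items + item 23091 + THREE of crux 19064's five r17 children — ROAD A.** The 19064 line's r17
(lead x11a-p1 g7) re-keys the `p ≥ 5` residual on `stub_mazurMCAtDeepFive` (`hMC5`: Mazur's cyclotomic main conjecture `X2.MazurMainConjectureAt` at every
X11a pair with `p ≥ 5` whose `#Ш_an` is not a `p`-adic unit — OPEN class-wide at a multiplicative prime without (ram)); of the shared nine `h9` only
modularity, Stein–Wuthrich 6.1 ×2 and Greenberg–Stevens are consumed, of `h2L` only GZK (`Birth.lowerX11aFive_of_children_r17_three`, p657610 §4). := p658518 ∘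
p657610. CONDITIONAL; closes nothing; BSD is proved for no curve. [cite: Skinner2016PacificMC, Thm. A (shape only)] [cite: SteinWuthrich2013, Thm. 6.1]
[cite: GrossLMS1991, Prop. 3.7 (2)] [cite: Jetchev2008, Thm. 1.4, Cor. 1.5] [cite: Miller2011LMS, Def. 1.1] -/
theorem eulerHalfNotRamNoInertSetAtFive_of_fiveItems_of_frobeniusCongruence_of_x11aChildrenR17Five
    (h₅ : PublishedInputsFive) (hJL : ShimuraParametrizationDataNonempty)
    (hCO : PastenComponentOrdersInput) (hCTi : ShimuraCasselsTateLevelInputs)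
    (hESi : ShimuraHeegnerEulerSystemInertPrintedR) (hF₁ : GrossFrobeniusCongruenceImageFreeFact)
    -- the 19064 line's r17 children texts (VERBATIM from `PrintX11aLowerHalfFiveOfChildren` §4)
    (h9 : thm61_splitMultiplicative ∧ thm61_nonsplitMultiplicative ∧
      (∀ (W : WeierstrassCurve ℚ) [W.IsElliptic] [W.IsGloballyMinimal] (p : ℕ) [Fact p.Prime],
        p ≠ 2 → greenberg_stevens (W := W) (p := p)) ∧
      Kato2004.thm12_4 ∧ exists_isNewformOf ∧
      Kato2004.exists_multDivisibilityInputs_nonsplit_contra ∧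
      Kato2004.exists_multDivisibilityInputs_split_contra ∧
      Kato2004.exists_multDivisibilityInputs_fine_contra ∧ mazur_not_dvd_maninConstant_of_odd)
    (h2L : kato_charIdeal_dvd_multiplicative_of_surjective ∧ rank_eq_analyticRank_of_analyticRank_le_one)
    (hMC5 : ∀ (W : WeierstrassCurve ℚ) [W.IsElliptic] [W.IsGloballyMinimal] (p : ℕ) [Fact p.Prime],
      ClassX11a W p → 5 ≤ p → ¬ X11a.ShaAnUnit W p → X2.MazurMainConjectureAt W p) :
    EulerHalfNotRamNoInertSetAtFive :=
  eulerHalfNotRamNoInertSetAtFive_of_fiveItems_of_frobeniusCongruence_of_lowerX11aFive h₅ hJL hCO hCTi hESi hF₁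
    (Birth.lowerX11aFive_of_children_r17_three h9 h2L hMC5)

/-- **The same, ROAD B.** CONDITIONAL; closes nothing; BSD is proved for no curve. [cite: Skinner2016PacificMC, Thm. A (shape only)]
[cite: GrossLMS1991, Prop. 3.7 (2), §6] [cite: PastenShimura2024, Lemma 6.18] -/
theorem eulerHalfNotRamNoInertSetAtFive_of_fiveItems_of_frobeniusCongruence_of_x11aChildrenR17Five_roadB
    (h₅ : PublishedInputsFive) (hJL : ShimuraParametrizationDataNonempty)
    (hCO : PastenComponentOrdersInput) (hCTi : ShimuraCasselsTateLevelInputs)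
    (hESi : ShimuraHeegnerEulerSystemInertPrintedR) (hF₁ : GrossFrobeniusCongruenceImageFreeFact)
    (h9 : thm61_splitMultiplicative ∧ thm61_nonsplitMultiplicative ∧
      (∀ (W : WeierstrassCurve ℚ) [W.IsElliptic] [W.IsGloballyMinimal] (p : ℕ) [Fact p.Prime],
        p ≠ 2 → greenberg_stevens (W := W) (p := p)) ∧
      Kato2004.thm12_4 ∧ exists_isNewformOf ∧
      Kato2004.exists_multDivisibilityInputs_nonsplit_contra ∧
      Kato2004.exists_multDivisibilityInputs_split_contra ∧
      Kato2004.exists_multDivisibilityInputs_fine_contra ∧ mazur_not_dvd_maninConstant_of_odd)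
    (h2L : kato_charIdeal_dvd_multiplicative_of_surjective ∧ rank_eq_analyticRank_of_analyticRank_le_one)
    (hMC5 : ∀ (W : WeierstrassCurve ℚ) [W.IsElliptic] [W.IsGloballyMinimal] (p : ℕ) [Fact p.Prime],
      ClassX11a W p → 5 ≤ p → ¬ X11a.ShaAnUnit W p → X2.MazurMainConjectureAt W p) :
    EulerHalfNotRamNoInertSetAtFive :=
  eulerHalfNotRamNoInertSetAtFive_of_fiveItems_of_frobeniusCongruence_of_lowerX11aFive_roadB h₅ hJL hCO hCTi hESi hF₁
    (Birth.lowerX11aFive_of_children_r17_three h9 h2L hMC5)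

end Summit.BirchSwinnertonDyer.BirchSwinnertonDyer.Theorems.EulerHalfLowerX11aFive

end
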